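import Mathlib
import Summits.Ventures.HodgeRepro2.T5CyclotomicSubfieldHeckeSummary
import Summits.Ventures.HodgeRepro2.T5IntegralGramBadSet

/-!
# FOR AN INTEGRAL UNIMODULAR GRAM MATRIX THE EXCEPTIONAL SET IS CONTAINED IN THE PLACES ABOVE `m`

Tier-5 support N3 / §G-N4.2 (seat p3, gen 82). Files 304 / 306 / 307 carry the hypothesis «every place of `F` above
`v` is good for `H`» (file 222's bad set); file 311 discharges it for every `H = M.map ι` with `M ∈ GL₃(𝓞_F)`. For
such `H` (hermitian) and every CM subfield `F ⊆ ℚ(ζₘ)` the statements read with no local hypothesis at all: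

* **`recordCommutative_cyclotomic_subfield_integral`** — `H(U(1 ⊗ H), K_v)` is commutative at EVERY place `v` of
  `F⁺` above a prime `p ∤ m`; **`recordPolynomial_cyclotomic_subfield_integral_of_mem`** — `k[X]` when
  `(−1) · H_F ∈ ⟨p · H_F⟩`; **`recordCommutative_cyclotomic_subfield_integral_of_notMem`** — commutative at every
  `v` with `m ∉ v`;
* **`mem_of_not_recordCommutative`** — THE EXCEPTIONAL SET IS CONTAINED IN THE PLACES ABOVE `m`: a place at which
  the algebra is not commutative contains `m`;
* **`infinite_setOf_recordPolynomial_integral`**, **`infinite_setOf_ncard_primesOver_eq_two_and_recordCommutative_integral`**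
  — the infinitude statements of file 306 with no bad-set hypothesis.

§8(d): uses an L-value-free non-vanishing device: NO.
-/

open Matrix NumberField NumberField.IsCMField IsDedekindDomain IsDedekindDomain.HeightOneSpectrum Module Polynomial
  Ideal
open scoped TensorProduct Pointwise
open Summit.Ventures.HodgeRepro2.T5UnitaryGroupForm Summit.Ventures.HodgeRepro2.T5UnitaryHeckeAdjoint
  Summit.Ventures.HodgeRepro2.T5HeckePermutationModule Summit.Ventures.HodgeRepro2.T5HeckeDoubleCoset
  Summit.Ventures.HodgeRepro2.T5RecordHyperspecial Summit.Ventures.HodgeRepro2.T5GlobalLatticeAlmostAll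
  Summit.Ventures.HodgeRepro2.T5FinitePlaceSplitClassification Summit.Ventures.HodgeRepro2.T5RecordSatakeIntrinsic
  Summit.Ventures.HodgeRepro2.T5SplitPlaceUnitaryGroup Summit.Ventures.HodgeRepro2.T5NonSplitPlaceUnitaryGroup
  Summit.Ventures.HodgeRepro2.T5FinitePlaceCM Summit.Ventures.HodgeRepro2.T5StarOfInvolution
  Summit.Ventures.HodgeRepro2.T5CyclotomicSubfieldHeckeCommutative
  Summit.Ventures.HodgeRepro2.T5CyclotomicSubfieldHeckeInfinitude
  Summit.Ventures.HodgeRepro2.T5CyclotomicSubfieldInertiaDeg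
  Summit.Ventures.HodgeRepro2.T5IntegralGramBadSet

namespace Summit.Ventures.HodgeRepro2.T5CyclotomicSubfieldHeckeIntegral

variable (m : ℕ) [NeZero m] (L : Type*) [Field L] [NumberField L] [IsCyclotomicExtension {m} ℚ L] [IsCMField L]
  (F : IntermediateField ℚ L) [IsCMField F]
variable (M : Matrix (Fin 3) (Fin 3) (𝓞 F)) (hM : IsUnit M.det)
  (hH : ((algebraMap (𝓞 F) F).mapMatrix M).IsHermitian)

section Places

variable (p : ℕ) [hp : Fact p.Prime] (hpm : p.Coprime m)
  (𝔭 : Ideal (𝓞 F)) [h𝔭 : 𝔭.IsPrime] [h𝔭p : 𝔭.LiesOver (span {(p : ℤ)})]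
  (v : HeightOneSpectrum (𝓞 (maximalRealSubfield F))) [hPv : 𝔭.LiesOver v.asIdeal]
variable {r : ℕ} (l : Fin r → 𝓞 F) (k : Type*) [Field k]
  (hl : Submodule.span (𝓞 (maximalRealSubfield F)) (Set.range l) = ⊤)

include hM hH hpm h𝔭 h𝔭p hPv hl in
/-- **COMMUTATIVE AT EVERY PLACE OF `F⁺` ABOVE `p ∤ m`**, for every hermitian `H = M.map ι` with `M ∈ GL₃(𝓞_F)` — no
local hypothesis (file 304 with file 311's empty bad set). -/
theorem recordCommutative_cyclotomic_subfield_integral :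
    RecordCommutative F v l k ((algebraMap (𝓞 F) F).mapMatrix M) :=
  recordCommutative_cyclotomic_subfield m L F p hpm 𝔭 v l k hl hH (isUnit_det_mapMatrix M hM)
    (forall_notMem_badSet_mapMatrix v M hM)

include hM hH hpm h𝔭 h𝔭p hPv hl in
/-- **`k[X]` at every non-split place above `p ∤ m`** (`(−1) · H_F ∈ ⟨p · H_F⟩`), no local hypothesis. -/
theorem recordPolynomial_cyclotomic_subfield_integral_of_mem
    (hmem : (QuotientGroup.mk (-1) : (ZMod m)ˣ ⧸ zmodSubgroup m L F) ∈
      Subgroup.zpowers (QuotientGroup.mk (ZMod.unitOfCoprime p hpm))) :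
    RecordPolynomial F v l k ((algebraMap (𝓞 F) F).mapMatrix M) :=
  recordPolynomial_cyclotomic_subfield_of_mem m L F p hpm 𝔭 v l k hmem hl hH (isUnit_det_mapMatrix M hM)
    (forall_notMem_badSet_mapMatrix v M hM)

end Places

section Intrinsic

variable (v : HeightOneSpectrum (𝓞 (maximalRealSubfield F)))
variable {r : ℕ} (l : Fin r → 𝓞 F) (k : Type*) [Field k]
  (hl : Submodule.span (𝓞 (maximalRealSubfield F)) (Set.range l) = ⊤)

include hM hH hl in
/-- **Commutative at every place `v` of `F⁺` with `m ∉ v`**, no local hypothesis. -/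
theorem recordCommutative_cyclotomic_subfield_integral_of_notMem
    (hmv : ((m : ℕ) : 𝓞 (maximalRealSubfield F)) ∉ v.asIdeal) :
    RecordCommutative F v l k ((algebraMap (𝓞 F) F).mapMatrix M) :=
  recordCommutative_cyclotomic_subfield_of_notMem m L F v hmv l k hl hH (isUnit_det_mapMatrix M hM)
    (forall_notMem_badSet_mapMatrix v M hM)

include hM hH hl in
/-- **THE EXCEPTIONAL SET IS CONTAINED IN THE PLACES ABOVE `m`**: a place `v` of `F⁺` at which `H(U(1 ⊗ H), K_v)`
is not commutative contains `m`. -/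
theorem mem_of_not_recordCommutative
    (h : ¬ RecordCommutative F v l k ((algebraMap (𝓞 F) F).mapMatrix M)) :
    ((m : ℕ) : 𝓞 (maximalRealSubfield F)) ∈ v.asIdeal := by
  by_contra hmv
  exact h (recordCommutative_cyclotomic_subfield_integral_of_notMem m L F M hM hH v l k hl hmv)

end Intrinsic

section Infinite

variable (k : Type*) [Field k]

include m hM hH in
/-- **`k[X]` at infinitely many places of `F⁺`**, no local hypothesis (file 306). -/
theorem infinite_setOf_recordPolynomial_integral :
    {v : HeightOneSpectrum (𝓞 (maximalRealSubfield F)) | ∀ {r : ℕ} (l : Fin r → 𝓞 F),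
      Submodule.span (𝓞 (maximalRealSubfield F)) (Set.range l) = ⊤ →
        RecordPolynomial F v l k ((algebraMap (𝓞 F) F).mapMatrix M)}.Infinite :=
  infinite_setOf_recordPolynomial m L F k hH (isUnit_det_mapMatrix M hM)

include m hM hH in
/-- **Infinitely many split places at which the algebra is commutative**, no local hypothesis (file 306). -/
theorem infinite_setOf_ncard_primesOver_eq_two_and_recordCommutative_integral :
    {v : HeightOneSpectrum (𝓞 (maximalRealSubfield F)) | (v.asIdeal.primesOver (𝓞 F)).ncard = 2 ∧
      ∀ {r : ℕ} (l : Fin r → 𝓞 F), Submodule.span (𝓞 (maximalRealSubfield F)) (Set.range l) = ⊤ →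
        RecordCommutative F v l k ((algebraMap (𝓞 F) F).mapMatrix M)}.Infinite :=
  infinite_setOf_ncard_primesOver_eq_two_and_recordCommutative m L F k hH (isUnit_det_mapMatrix M hM)

end Infinite

end Summit.Ventures.HodgeRepro2.T5CyclotomicSubfieldHeckeIntegral
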